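import Literature.AnabelianGeometry.SemiGraphs.TemperedCompactInVerticialAt
import Literature.AnabelianGeometry.SemiGraphs.TemperedVerticialPairProofs
import HarnessLib

/-!
# [SemiAnbd] Thm 3.7 (iii), located form — PER-GRAPH twin (cell ruling φ2 / α4-3 (ii))

Mochizuki, *Semi-graphs of anabelioids*, Publ. RIMS **42** (2006), §3, Theorem 3.7 (ii)–(iv), manuscript
pp. 40–41 [cite: MochizukiSemiAnbd2006, Thm 3.7(iii)(iv) pp.40-41].

PROOF-ONLY companion of `TemperedVerticialPairProofs.lean` (abc-iut cell wave-4 seat abc-iut-w4-d075,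
L3-lead ruling α4-3 (ii)
«φ2-CONSUMERS»): the same theorems with the ∀-countable named facts `CompactInVerticial` /
`MaximalCompactIffVerticial` / `EdgeLikeIsInfVerticial` / `EdgeLikeDistinct` replaced by their per-graph
forms `…At 𝒢` (`TemperedCompactInVerticialAt.lean`), so that the finite-`𝔾` producer
(`compactInVerticialAt_of_finiteLevelData`) feeds them; proofs ported VERBATIM with `hCV 𝒢 ↦ hCV`
(the `Thm37Hypotheses` argument stays).  Original file untouched.  No definitions, no new named fact;
nothing here asserts Thm 3.7 (iii) for an infinite `𝔾`, and nothing bears on [IUTchIII] Cor. 3.12.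
-/

namespace Literature.AnabelianGeometry.SemiGraphs

namespace ProfiniteSemiGraph

open Topology

universe u w

variable {𝒢 ℋ : ProfiniteSemiGraph.{u}}

/-- **Theorem 3.7 (iii), located form** ([SemiAnbd] pp. 40–41: "precisely two verticial subgroups
`Π_{v₁}`, `Π_{v₂}`, where `v₁`, `v₂` are the vertices joined by some edge `e` … this compact
subgroup is contained in … `e`"), from the typed `CompactInVerticial`, Thm. 3.7 (i) and the pair
lemma: a nontrivial compact subgroup contained in two distinct verticial subgroups `H₁` (at `v₁`) and
`H₂` (at `v₂`) lies in an edge-like subgroup of an edge `e` with distinct branches `b₁`, `b₂`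
abutting to `v₁` and `v₂`. [cite: MochizukiSemiAnbd2006, Thm 3.7(iii) pp.40-41] -/
theorem compactInVerticial_located_at (h37i : VerticialInjective.{u}) (h37iii : CompactInVerticialAt ℋ)
    (hℋ : Cor39Hypotheses ℋ) (c : TemperedPiChart ℋ) {C : Subgroup c.G}
    (hC : IsCompact (C : Set c.G)) (hC0 : C ≠ ⊥) {v₁ v₂ : ℋ.graph.Vertex} {H₁ H₂ : Subgroup c.G}
    (hH₁ : H₁ ∈ verticialSubgroups c v₁) (hH₂ : H₂ ∈ verticialSubgroups c v₂) (hne : H₁ ≠ H₂)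
    (hC₁ : C ≤ H₁) (hC₂ : C ≤ H₂) :
    ∃ (e : ℋ.graph.Edge) (b₁ b₂ : ℋ.graph.Branch), b₁ ≠ b₂ ∧ ℋ.graph.edgeOf b₁ = e ∧
      ℋ.graph.edgeOf b₂ = e ∧ ℋ.graph.abuts b₁ = some v₁ ∧ ℋ.graph.abuts b₂ = some v₂ ∧
      ∃ L ∈ edgeLikeSubgroups c e, C ≤ L := by
  have h37 := hℋ.thm37Hypotheses
  obtain ⟨hall, e, L, -, hL, hCL⟩ := (h37iii h37 c C hC).2 hC0 v₁ v₂ H₁ H₂ hH₁ hH₂ hne hC₁ hC₂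
  obtain ⟨b₁, b₂, hb, hb₁, hb₂, -⟩ := ℋ.graph.two_branches e
  obtain ⟨w₁, hw₁⟩ := Option.isSome_iff_exists.mp (hℋ.isGraph.abuts_isSome b₁)
  obtain ⟨w₂, hw₂⟩ := Option.isSome_iff_exists.mp (hℋ.isGraph.abuts_isSome b₂)
  obtain ⟨P₁, hP₁, P₂, hP₂, hPne, hLP₁, hLP₂⟩ :=
    exists_verticial_pair_of_mem_edgeLikeSubgroups h37i hℋ c hb hb₁ hb₂ hw₁ hw₂ hL
  rcases hall w₁ P₁ hP₁ (hCL.trans hLP₁) with rfl | rfl <;>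
    rcases hall w₂ P₂ hP₂ (hCL.trans hLP₂) with h₂ | h₂
  · exact absurd h₂.symm hPne
  · subst h₂
    exact ⟨e, b₁, b₂, hb, hb₁, hb₂, (vertex_eq_of_mem_verticialSubgroups h37 c hP₁ hH₁) ▸ hw₁,
      (vertex_eq_of_mem_verticialSubgroups h37 c hP₂ hH₂) ▸ hw₂, L, hL, hCL⟩
  · subst h₂
    exact ⟨e, b₂, b₁, hb.symm, hb₂, hb₁, (vertex_eq_of_mem_verticialSubgroups h37 c hP₂ hH₁) ▸ hw₂,
      (vertex_eq_of_mem_verticialSubgroups h37 c hP₁ hH₂) ▸ hw₁, L, hL, hCL⟩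
  · exact absurd h₂.symm hPne

end ProfiniteSemiGraph

end Literature.AnabelianGeometry.SemiGraphs
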